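import Summits.CriticalPhenomena.PercolationContinuityZ3.Theorems.Transplant.SiteA2H
import Summits.CriticalPhenomena.PercolationContinuityZ3.Theorems.Transplant.SiteHpart
import HarnessLib

/-!
# SITE percolation: the dictionary between the finite weight-sum framework (`SiteCovTau.*` on `srest`) and the world-kernel vocabulary
# (`prodBernoulli (SiteCSH.worldQ …)`), (Htw)_site in world form, and LEMMA H from the one-source bounds
# (WP4/WP5 of P1-SITE-Z3 §12; site twin of `Theorems/PercNearOneGluingAdditiveGluingCSHHtwBridge.lean`)

builds on p205010 (kernel theorem, internal audit signed; external expert review pending).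

* `mem_srest_univ_iff` — the site world `srest univ Y ω` is the complement of `SiteCSH.worldDead Γ Y ω` (p211418);
* `sum_weight_srest_univ` — fresh sums over the site world are integrals against the world kernel `worldQ` (zeroing = restriction,
  `BHK2006.integral_comp_sdiff_prodBernoulli`);
* `BfS_srest_univ`, `qav_srest_univ`, `Mav_univ_eq`, `Eav_univ_eq`, `Yw_univ_eq`, `Xw_univ_eq` — the dictionary;
* **`htw_world_of_star`** — (Htw)_site in the vocabulary of `SiteCSH.siteHpart_nonneg_of_htw`, from `SiteCovTau.p1H_univ_of_star`;
* **`siteHpart_nonneg_of_star`** — site LEMMA H from (K6)_site and the two site one-source bounds (★^H)_site, (Y^H ≤ H)_site only (WP3 targets).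
Support file (`--supports stmt-CriticalPhenomena-4575 --as helper`); no definitions, no named facts, no sorries.
[cite: VandenbergHaggstromKahn2005, §2.1 Lemmas 2.3–2.4 (p. 10), Thm. 1.4 (p. 7)] [cite: KozmaNitzan2024, Conj. 4 (p. 32)]
-/

noncomputable section

namespace Summit.CriticalPhenomena.PercolationContinuityZ3.Theorems.Transplant

namespace SiteCovTau

open MeasureTheory Set
open Literature.Probability.LatticeModels (prodBernoulli)
open Literature.Probability.Percolation
open Literature.Probability.Percolation.BHK2006 (weight integral_prodBernoulli_eq_sum integral_comp_sdiff_prodBernoulli)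
open Literature.Probability.Percolation.DecisionTree (ind ind_of_mem ind_of_not_mem ind_nonneg)
open Summit.CriticalPhenomena.PercolationContinuityZ3.Theorems.SiteTransplant (siteConn mem_siteConn)
open SiteBHK (sC sD srest setC mem_srest mem_setC sC_univ)
open SiteCSH (worldDead worldQ)
open scoped Classical

variable {V : Type*} [Fintype V] {Γ : SimpleGraph V}

/-! ### The site world of `Y` on the whole graph is the complement of the dead set -/

omit [Fintype V] in
/-- Restricted clusters are clusters of the restricted configuration. [folklore] -/
theorem sC_eq_siteCluster_inter (U : Finset V) (x : V) (η : Set V) : sC Γ U x η = siteCluster Γ (η ∩ ↑U) x := rfl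

/-- `srest univ Y ω = (worldDead Γ Y ω)ᶜ`. [folklore] -/
theorem mem_srest_univ_iff (Y : Set V) (ω : Set V) (u : V) : u ∈ srest Γ Finset.univ Y ω ↔ u ∉ worldDead Γ Y ω := by
  rw [mem_srest]
  simp only [SiteCSH.worldDead, mem_setOf_eq, mem_setC, sC_univ]
  constructor
  · rintro ⟨-, huY, huC, hadj⟩ hdead
    rcases hdead with huY' | ⟨y, hy, hu | ⟨z, hz, huz⟩⟩
    · exact huY huY'
    · exact huC ⟨y, hy, hu⟩
    · exact hadj z ⟨y, hy, hz⟩ huz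
  · intro h
    refine ⟨Finset.mem_univ u, fun huY => h (Or.inl huY), ?_, ?_⟩
    · rintro ⟨y, hy, hu⟩; exact h (Or.inr ⟨y, hy, Or.inl hu⟩)
    · rintro c ⟨y, hy, hc⟩ huc; exact h (Or.inr ⟨y, hy, Or.inr ⟨c, hc, huc⟩⟩)

/-- Reading a configuration on the site world deletes exactly the dead vertices. [folklore] -/
theorem inter_srest_univ_eq_diff (Y : Set V) (ω η : Set V) : η ∩ ↑(srest Γ Finset.univ Y ω) = η \ worldDead Γ Y ω := by
  ext u
  simp only [mem_inter_iff, Finset.mem_coe, mem_srest_univ_iff, mem_sdiff]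

/-- **Fresh sums over the site world are integrals against the world kernel.** [cite: VandenbergHaggstromKahn2005, §2.1 Lemmas 2.3–2.4 (p. 10)] -/
theorem sum_weight_srest_univ (q : V → unitInterval) (Y : Set V) (ω : Set V) (G : Set V → ℝ) :
    ∑ η, weight (fun u => (q u : ℝ)) η * G (η ∩ ↑(srest Γ Finset.univ Y ω)) = ∫ η, G η ∂(prodBernoulli (worldQ Γ q Y ω)) := by
  simp only [inter_srest_univ_eq_diff]
  rw [← integral_prodBernoulli_eq_sum q (fun η => G (η \ worldDead Γ Y ω)), integral_comp_sdiff_prodBernoulli q (worldDead Γ Y ω) G]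
  rfl

/-- Sums against the weight are integrals. [folklore] -/
theorem sum_weight_eq_integral (q : V → unitInterval) (G : Set V → ℝ) :
    ∑ η, weight (fun u => (q u : ℝ)) η * G η = ∫ η, G η ∂(prodBernoulli q) := (integral_prodBernoulli_eq_sum q G).symm

omit [Fintype V] in
/-- `ind D = 1_D`. [folklore] -/
theorem ind_eq_indicator (D : Set (Set V)) (η : Set V) : ind D η = D.indicator (1 : Set V → ℝ) η := by
  by_cases h : η ∈ D
  · rw [ind_of_mem h, indicator_of_mem h, Pi.one_apply]
  · rw [ind_of_not_mem h, indicator_of_notMem h]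

/-- Sums of `h · 1_D` against the weight are set integrals. [folklore] -/
theorem sum_weight_mul_ind_eq_setIntegral (q : V → unitInterval) (h : Set V → ℝ) (D : Set (Set V)) :
    ∑ η, weight (fun u => (q u : ℝ)) η * (h η * ind D η) = ∫ η in D, h η ∂(prodBernoulli q) := by
  rw [sum_weight_eq_integral, ← integral_indicator MeasurableSet.of_discrete]
  congr 1; funext η
  by_cases hη : η ∈ D
  · rw [ind_of_mem hη, mul_one, indicator_of_mem hη]
  · rw [ind_of_not_mem hη, mul_zero, indicator_of_notMem hη]

/-- Sums of `1_D` against the weight are probabilities. [folklore] -/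
theorem sum_weight_ind_eq_real (q : V → unitInterval) (D : Set (Set V)) :
    ∑ η, weight (fun u => (q u : ℝ)) η * ind D η = (prodBernoulli q).real D := by
  rw [sum_weight_eq_integral]
  simp only [ind_eq_indicator]
  exact integral_indicator_one MeasurableSet.of_discrete

/-! ### The dictionary -/

omit [Fintype V] in
/-- `{v ↔ S}` read on the world: the complement of the restricted avoidance event is the union of the site connection events of the restricted
configuration. [folklore] -/
theorem ind_compl_sD_eq (U : Finset V) (v : V) (S : Finset V) (η : Set V) :
    ind (sD Γ U v (↑S : Set V))ᶜ η = ind (⋃ t ∈ S, siteConn Γ v t) (η ∩ ↑U) := by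
  have hiff : η ∈ (sD Γ U v (↑S : Set V))ᶜ ↔ η ∩ ↑U ∈ ⋃ t ∈ S, siteConn Γ v t := by
    simp only [mem_compl_iff, sD, mem_setOf_eq, not_forall, not_not, Finset.mem_coe, mem_iUnion, exists_prop,
      SiteGen.mem_siteConn_iff_mem_siteCluster, sC_eq_siteCluster_inter]
  by_cases h : η ∈ (sD Γ U v (↑S : Set V))ᶜ
  · rw [ind_of_mem h, ind_of_mem (hiff.1 h)]
  · rw [ind_of_not_mem h, ind_of_not_mem fun h' => h (hiff.2 h')]

/-- **`H^S` in the site world is the world-kernel covariance bracket.** [cite: VandenbergHaggstromKahn2005, §2.1 Lemmas 2.3–2.4 (p. 10)] -/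
theorem BfS_srest_univ (q : V → unitInterval) (x v : V) (S : Finset V) (Y : Set V) (g : Set V → ℝ) (ω : Set V) :
    BfS Γ (fun u => (q u : ℝ)) (srest Γ Finset.univ Y ω) x (↑S : Set V) v g =
      (∫ η in (⋃ t ∈ S, siteConn Γ v t), g (siteCluster Γ η x) ∂(prodBernoulli (worldQ Γ q Y ω))) -
        (prodBernoulli (worldQ Γ q Y ω)).real (⋃ t ∈ S, siteConn Γ v t) *
          (∫ η, g (siteCluster Γ η x) ∂(prodBernoulli (worldQ Γ q Y ω))) := by
  set W := srest Γ Finset.univ Y ω with hW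
  set μW := prodBernoulli (worldQ Γ q Y ω) with hμW
  have h1 : tfS Γ (fun u => (q u : ℝ)) W x g = ∫ η, g (siteCluster Γ η x) ∂μW := by
    have h := sum_weight_srest_univ q Y ω (fun ζ => g (siteCluster Γ ζ x)) (Γ := Γ)
    refine Eq.trans ?_ h
    rw [tfS]
    rfl
  have h2 : cfS Γ (fun u => (q u : ℝ)) W (↑S : Set V) v = ∫ η, ind (⋃ t ∈ S, siteConn Γ v t) η ∂μW := by
    have h := sum_weight_srest_univ q Y ω (fun ζ => ind (⋃ t ∈ S, siteConn Γ v t) ζ) (Γ := Γ)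
    refine Eq.trans ?_ h
    rw [cfS]
    exact Finset.sum_congr rfl fun η _ => by rw [ind_compl_sD_eq]
  have h3 : (∑ η, weight (fun u => (q u : ℝ)) η * (g (sC Γ W x η) * ind (sD Γ W v (↑S : Set V))ᶜ η)) =
      ∫ η, g (siteCluster Γ η x) * ind (⋃ t ∈ S, siteConn Γ v t) η ∂μW := by
    have h := sum_weight_srest_univ q Y ω (fun ζ => g (siteCluster Γ ζ x) * ind (⋃ t ∈ S, siteConn Γ v t) ζ) (Γ := Γ)
    refine Eq.trans ?_ h
    refine Finset.sum_congr rfl fun η _ => ?_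
    rw [ind_compl_sD_eq, sC_eq_siteCluster_inter]
  have h2' : ∫ η, ind (⋃ t ∈ S, siteConn Γ v t) η ∂μW = μW.real (⋃ t ∈ S, siteConn Γ v t) := by
    simp only [ind_eq_indicator]; exact integral_indicator_one MeasurableSet.of_discrete
  have h4 : ∫ η, g (siteCluster Γ η x) * ind (⋃ t ∈ S, siteConn Γ v t) η ∂μW =
      ∫ η in (⋃ t ∈ S, siteConn Γ v t), g (siteCluster Γ η x) ∂μW := by
    rw [← integral_indicator MeasurableSet.of_discrete]
    congr 1
    funext η
    by_cases h : η ∈ (⋃ t ∈ S, siteConn Γ v t)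
    · rw [ind_of_mem h, mul_one, indicator_of_mem h]
    · rw [ind_of_not_mem h, mul_zero, indicator_of_notMem h]
  rw [BfS, h1, h2, h3, h2', h4]
  ring

omit [Fintype V] in
/-- The restricted avoidance event on the world, read as a global event of the restricted configuration. [folklore] -/
theorem ind_sD_eq (U : Finset V) (v : V) (X : Set V) (η : Set V) :
    ind (sD Γ U v X) η = ind {ζ : Set V | ∀ t ∈ X, t ∉ siteCluster Γ ζ v} (η ∩ ↑U) := by
  have hiff : η ∈ sD Γ U v X ↔ η ∩ ↑U ∈ {ζ : Set V | ∀ t ∈ X, t ∉ siteCluster Γ ζ v} := by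
    simp only [sD, mem_setOf_eq, sC_eq_siteCluster_inter]
  by_cases h : η ∈ sD Γ U v X
  · rw [ind_of_mem h, ind_of_mem (hiff.1 h)]
  · rw [ind_of_not_mem h, ind_of_not_mem fun h' => h (hiff.2 h')]

/-- **`q_S` in the site world** = `μ_W(v ↮ S, o ↔ v) / μ_W(v ↮ S)` for the world kernel. [cite: VandenbergHaggstromKahn2005, §2.1 Lemmas 2.3–2.4 (p. 10)] -/
theorem qav_srest_univ (q : V → unitInterval) (o v : V) (S : Finset V) (Y : Set V) (ω : Set V) :
    qav Γ (fun u => (q u : ℝ)) (srest Γ Finset.univ Y ω) (↑S : Set V) o v =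
      (prodBernoulli (worldQ Γ q Y ω)).real ({η : Set V | ∀ t ∈ S, t ∉ siteCluster Γ η v} ∩ siteConn Γ o v) /
        (prodBernoulli (worldQ Γ q Y ω)).real {η : Set V | ∀ t ∈ S, t ∉ siteCluster Γ η v} := by
  set W := srest Γ Finset.univ Y ω with hW
  set μW := prodBernoulli (worldQ Γ q Y ω) with hμW
  have hset : {ζ : Set V | ∀ t ∈ (↑S : Set V) ∪ (∅ : Set V), t ∉ siteCluster Γ ζ v} = {η : Set V | ∀ t ∈ S, t ∉ siteCluster Γ η v} := by
    ext ζ; simp only [union_empty, mem_setOf_eq, Finset.mem_coe]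
  have hoInd : ∀ ζ : Set V, oInd o (siteCluster Γ ζ v) = ind (siteConn Γ o v) ζ := by
    intro ζ
    have hiff : siteCluster Γ ζ v ∈ {C : Set V | o ∈ C} ↔ ζ ∈ siteConn Γ o v := by
      rw [mem_setOf_eq, SiteGen.siteConn_comm Γ o v, SiteGen.mem_siteConn_iff_mem_siteCluster]
    by_cases h : ζ ∈ siteConn Γ o v
    · rw [oInd, ind_of_mem (hiff.2 h), ind_of_mem h]
    · rw [oInd, ind_of_not_mem (fun h' => h (hiff.1 h')), ind_of_not_mem h]
  have h1 : Eav Γ (fun u => (q u : ℝ)) W (↑S : Set V) o v ∅ =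
      ∫ η, ind ({η : Set V | ∀ t ∈ S, t ∉ siteCluster Γ η v} ∩ siteConn Γ o v) η ∂μW := by
    have h := sum_weight_srest_univ q Y ω
      (fun ζ => ind ({η : Set V | ∀ t ∈ S, t ∉ siteCluster Γ η v} ∩ siteConn Γ o v) ζ) (Γ := Γ)
    refine Eq.trans ?_ h
    rw [Eav]
    refine Finset.sum_congr rfl fun η _ => ?_
    rw [sC_eq_siteCluster_inter, hoInd, ind_sD_eq, hset, ← BHK2006.ind_inter, inter_comm]
  have h2 : Mav Γ (fun u => (q u : ℝ)) W (↑S : Set V) v ∅ = ∫ η, ind {η : Set V | ∀ t ∈ S, t ∉ siteCluster Γ η v} η ∂μW := by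
    have h := sum_weight_srest_univ q Y ω (fun ζ => ind {η : Set V | ∀ t ∈ S, t ∉ siteCluster Γ η v} ζ) (Γ := Γ)
    refine Eq.trans ?_ h
    rw [Mav]
    refine Finset.sum_congr rfl fun η _ => ?_
    rw [ind_sD_eq, hset]
  rw [qav, h1, h2]
  simp only [ind_eq_indicator]
  rw [integral_indicator_one MeasurableSet.of_discrete, integral_indicator_one MeasurableSet.of_discrete]

/-- `M_S(Y) = μ(v ↮ S ∪ Y)` on the whole graph. [cite: VandenbergHaggstromKahn2005, §1 p. 3] -/
theorem Mav_univ_eq (q : V → unitInterval) (v : V) (S : Finset V) (Y : Set V) :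
    Mav Γ (fun u => (q u : ℝ)) Finset.univ (↑S : Set V) v Y =
      (prodBernoulli q).real {ω : Set V | ∀ a ∈ (↑S ∪ Y : Set V), a ∉ siteCluster Γ ω v} := by
  rw [Mav, ← sum_weight_ind_eq_real]
  refine Finset.sum_congr rfl fun ω _ => ?_
  rw [ind_sD_eq]
  simp

/-- `E_S(Y) = μ(v ↮ S ∪ Y, o ↔ v)` on the whole graph. [cite: VandenbergHaggstromKahn2005, §1 p. 3] -/
theorem Eav_univ_eq (q : V → unitInterval) (o v : V) (S : Finset V) (Y : Set V) :
    Eav Γ (fun u => (q u : ℝ)) Finset.univ (↑S : Set V) o v Y =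
      (prodBernoulli q).real ({ω : Set V | ∀ a ∈ (↑S ∪ Y : Set V), a ∉ siteCluster Γ ω v} ∩ siteConn Γ o v) := by
  rw [Eav, ← sum_weight_ind_eq_real]
  refine Finset.sum_congr rfl fun ω _ => ?_
  congr 1
  have hoInd : oInd o (sC Γ Finset.univ v ω) = ind (siteConn Γ o v) ω := by
    rw [sC_univ]
    have hiff : siteCluster Γ ω v ∈ {C : Set V | o ∈ C} ↔ ω ∈ siteConn Γ o v := by
      rw [mem_setOf_eq, SiteGen.siteConn_comm Γ o v, SiteGen.mem_siteConn_iff_mem_siteCluster]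
    by_cases h : ω ∈ siteConn Γ o v
    · rw [oInd, ind_of_mem (hiff.2 h), ind_of_mem h]
    · rw [oInd, ind_of_not_mem (fun h' => h (hiff.1 h')), ind_of_not_mem h]
  have hD : ind (sD Γ Finset.univ v ((↑S : Set V) ∪ Y)) ω = ind {ω : Set V | ∀ a ∈ (↑S ∪ Y : Set V), a ∉ siteCluster Γ ω v} ω := by
    rw [ind_sD_eq]; simp
  rw [hoInd, hD, ← BHK2006.ind_inter, inter_comm]

/-- `Y_F(Y)` on the whole graph as a set integral over `{x ↮ Y}`. [folklore] -/
theorem Yw_univ_eq (q : V → unitInterval) (x : V) (F : Finset V → ℝ) (Y : Set V) :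
    Yw Γ (fun u => (q u : ℝ)) Finset.univ x F Y =
      ∫ ω in {ω : Set V | ∀ y ∈ Y, y ∉ siteCluster Γ ω x}, F (srest Γ Finset.univ Y ω) ∂(prodBernoulli q) := by
  rw [Yw, ← sum_weight_mul_ind_eq_setIntegral]
  refine Finset.sum_congr rfl fun ω _ => ?_
  rw [ind_sD_eq]
  simp

/-- `X_F(Y)` on the whole graph as a set integral over `{x ↮ Y}`. [folklore] -/
theorem Xw_univ_eq (q : V → unitInterval) (x : V) (A : Set V) (o v : V) (F : Finset V → ℝ) (Y : Set V) :
    Xw Γ (fun u => (q u : ℝ)) Finset.univ x A o v F Y =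
      ∫ ω in {ω : Set V | ∀ y ∈ Y, y ∉ siteCluster Γ ω x},
        qav Γ (fun u => (q u : ℝ)) (srest Γ Finset.univ Y ω) A o v * F (srest Γ Finset.univ Y ω) ∂(prodBernoulli q) := by
  rw [Xw, ← sum_weight_mul_ind_eq_setIntegral]
  refine Finset.sum_congr rfl fun ω _ => ?_
  rw [ind_sD_eq]
  simp

/-! ### (Htw)_site in world form and LEMMA H from the one-source bounds -/

variable {n : ℕ} {Δ : SimpleGraph (Fin n)}

/-- **(Htw)_site in world form, from the site one-source bounds** (★^H)_site and (Y^H ≤ H)_site (hypotheses, WP3 targets): the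
hypothesis `hHtw` of `SiteCSH.siteHpart_nonneg_of_htw`. [cite: VandenbergHaggstromKahn2005, Thm. 1.1 (pp. 3–5), Thm. 1.4 (p. 7)] -/
theorem htw_world_of_star (q : Fin n → unitInterval) (x v o : Fin n) (S : Finset (Fin n)) (Y : Set (Fin n))
    (g : Set (Fin n) → ℝ) (hg : ∀ C C' : Set (Fin n), C ⊆ C' → g C ≤ g C') (hg0 : ∀ C, 0 ≤ g C)
    (hstar : ∀ U' : Finset (Fin n), ∀ N : Set (Fin n), N ⊆ ↑U' →
      Yw Δ (fun u => (q u : ℝ)) U' x (fun U'' => BfS Δ (fun u => (q u : ℝ)) U'' x ↑S v g) N *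
          Mav Δ (fun u => (q u : ℝ)) U' ↑S v ∅ ≤
        Mav Δ (fun u => (q u : ℝ)) U' ↑S v N * BfS Δ (fun u => (q u : ℝ)) U' x ↑S v g)
    (hYB : ∀ U' : Finset (Fin n), ∀ u : Fin n,
      Yw Δ (fun u => (q u : ℝ)) U' x (fun U'' => BfS Δ (fun u => (q u : ℝ)) U'' x ↑S v g) {u} ≤ BfS Δ (fun u => (q u : ℝ)) U' x ↑S v g) :
    (prodBernoulli q).real ({ω : Set (Fin n) | ∀ a ∈ (↑S ∪ Y : Set (Fin n)), a ∉ siteCluster Δ ω v} ∩ siteConn Δ o v) *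
        (∫ ω in {ω : Set (Fin n) | ∀ y ∈ Y, y ∉ siteCluster Δ ω x},
          ((∫ η in (⋃ t ∈ S, siteConn Δ v t), g (siteCluster Δ η x) ∂(prodBernoulli (worldQ Δ q Y ω))) -
            (prodBernoulli (worldQ Δ q Y ω)).real (⋃ t ∈ S, siteConn Δ v t) *
              (∫ η, g (siteCluster Δ η x) ∂(prodBernoulli (worldQ Δ q Y ω))))
          ∂(prodBernoulli q)) ≤
      (prodBernoulli q).real {ω : Set (Fin n) | ∀ a ∈ (↑S ∪ Y : Set (Fin n)), a ∉ siteCluster Δ ω v} *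
        (∫ ω in {ω : Set (Fin n) | ∀ y ∈ Y, y ∉ siteCluster Δ ω x},
          ((prodBernoulli (worldQ Δ q Y ω)).real
                ({η : Set (Fin n) | ∀ t ∈ S, t ∉ siteCluster Δ η v} ∩ siteConn Δ o v) /
              (prodBernoulli (worldQ Δ q Y ω)).real {η : Set (Fin n) | ∀ t ∈ S, t ∉ siteCluster Δ η v}) *
          ((∫ η in (⋃ t ∈ S, siteConn Δ v t), g (siteCluster Δ η x) ∂(prodBernoulli (worldQ Δ q Y ω))) -
            (prodBernoulli (worldQ Δ q Y ω)).real (⋃ t ∈ S, siteConn Δ v t) *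
              (∫ η, g (siteCluster Δ η x) ∂(prodBernoulli (worldQ Δ q Y ω))))
          ∂(prodBernoulli q)) := by
  have hq0 : ∀ u, 0 ≤ (q u : ℝ) := fun u => (q u).2.1
  have hq1 : ∀ u, (q u : ℝ) ≤ 1 := fun u => (q u).2.2
  have hm : ∑ ω, weight (fun u => (q u : ℝ)) ω = 1 := by
    have h1 := integral_prodBernoulli_eq_sum q fun _ => (1 : ℝ)
    simp only [integral_const, probReal_univ, smul_eq_mul, mul_one] at h1
    exact h1.symm
  have hgm : Monotone g := fun C C' h => hg C C' h
  have h := p1H_univ_of_star (Γ := Δ) (fun u => (q u : ℝ)) hq0 hq1 hm x v o (↑S : Set (Fin n)) hgm hg0 hstar hYB Y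
  rw [Eav_univ_eq, Mav_univ_eq, Yw_univ_eq, Xw_univ_eq] at h
  simp only [BfS_srest_univ, qav_srest_univ] at h
  exact h

/-- **LEMMA H (site) from (K6)_site and the two site one-source bounds only.** [cite: VandenbergHaggstromKahn2005, Thm. 1.4 (p. 7)] -/
theorem siteHpart_nonneg_of_star (q : Fin n → unitInterval) (hq : ∀ u, 0 < q u ∧ q u < 1) (x : Fin n) (Y : Set (Fin n))
    (S : Finset (Fin n)) (hxS : x ∈ S) (o v : Fin n) (g : Set (Fin n) → ℝ)
    (hg : ∀ C C' : Set (Fin n), C ⊆ C' → g C ≤ g C') (hg0 : ∀ C, 0 ≤ g C)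
    (hstar : ∀ U' : Finset (Fin n), ∀ N : Set (Fin n), N ⊆ ↑U' →
      Yw Δ (fun u => (q u : ℝ)) U' x (fun U'' => BfS Δ (fun u => (q u : ℝ)) U'' x ↑S v g) N *
          Mav Δ (fun u => (q u : ℝ)) U' ↑S v ∅ ≤
        Mav Δ (fun u => (q u : ℝ)) U' ↑S v N * BfS Δ (fun u => (q u : ℝ)) U' x ↑S v g)
    (hYB : ∀ U' : Finset (Fin n), ∀ u : Fin n,
      Yw Δ (fun u => (q u : ℝ)) U' x (fun U'' => BfS Δ (fun u => (q u : ℝ)) U'' x ↑S v g) {u} ≤ BfS Δ (fun u => (q u : ℝ)) U' x ↑S v g) :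
    0 ≤ ∫ ω in {ω : Set (Fin n) | ∀ y ∈ Y, y ∉ siteCluster Δ ω x},
      (((∫ η in (⋃ t ∈ S, siteConn Δ o t), g (siteCluster Δ η x) ∂(prodBernoulli (worldQ Δ q Y ω))) -
          (prodBernoulli (worldQ Δ q Y ω)).real (⋃ t ∈ S, siteConn Δ o t) *
            (∫ η, g (siteCluster Δ η x) ∂(prodBernoulli (worldQ Δ q Y ω)))) -
        SiteCSH.obsConst Δ q o v (↑S ∪ Y) *
          ((∫ η in (⋃ t ∈ S, siteConn Δ v t), g (siteCluster Δ η x) ∂(prodBernoulli (worldQ Δ q Y ω))) -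
            (prodBernoulli (worldQ Δ q Y ω)).real (⋃ t ∈ S, siteConn Δ v t) *
              (∫ η, g (siteCluster Δ η x) ∂(prodBernoulli (worldQ Δ q Y ω)))))
      ∂(prodBernoulli q) :=
  SiteCSH.siteHpart_nonneg_of_htw q hq x Y S hxS o v g hg hg0 (htw_world_of_star q x v o S Y g hg hg0 hstar hYB)

end SiteCovTau

end Summit.CriticalPhenomena.PercolationContinuityZ3.Theorems.Transplant
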